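import Literature.NumberTheory.GaloisRepresentations.MaxUnramifiedIntegers
import Literature.NumberTheory.GaloisRepresentations.PadicAlgebraOfLocalField
import Literature.AlgebraicGeometry.Resolution.AdicQuotient
import Literature.AlgebraicGeometry.Resolution.AdicCompletionRegular
import Literature.AlgebraicGeometry.Resolution.CompleteLocalDomainNormalization
import HarnessLib

/-!
# The completion `𝒪̂_{F_nr}` of the maximal unramified extension and its Frobenius invariants

Let `F` be a non-archimedean local field, `𝒪_{F_nr} = maxUnramifiedIntegers F` the ring of
integers of `F_nr = F(μ_{p'}) ⊆ F̄` (a discrete valuation ring with uniformiser `ϖ_F` and residue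
field `k̄ = S ⧸ 𝔓`, file `MaxUnramifiedIntegers`).  This file constructs

* `maxUnramifiedCompletion F = 𝒪̂_{F_nr}`, the `𝔪`-adic completion (Mathlib `AdicCompletion`):
  a complete discrete valuation ring (`instIsDiscreteValuationRing`; regularity and dimension of
  completions from `Literature.AlgebraicGeometry.Resolution.AdicCompletionRegular`) with
  uniformiser `ϖ_F` (`maximalIdeal_eq_span_uniformizer`) — i.e. `W(k̄) ⊗_{W(k)} 𝒪_F`, the ring of
  integers of `F̂_nr`;
* the action of `Gal(F̄/F)` on it by continuity (`galAut`, functoriality of adic completions,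
  `Literature.AlgebraicGeometry.Resolution.adicCompletionCongr`), trivial on the inertia group
  (`smul_eq_self_of_mem_absInertia`), an arithmetic Frobenius `σ₀` acting as `x ↦ x ^ q` modulo
  `𝔪̂` (`IsAbsArithFrob.smul_sub_pow_mem_maximalIdeal_completion`);
* **`(𝒪̂_{F_nr})^{σ₀ = 1} = 𝒪_F`** (`mem_range_algebraMap_of_smul_eq`): an element fixed by an
  arithmetic Frobenius lies in `𝒪_F` — the `ϖ`-adic dévissage "`x ≡ a₀ (𝔪̂)` with `a₀ ∈ 𝒪_F`
  since `k̄^{Frob} = k`, then `(x - a₀)/ϖ` is again fixed", summed up using the completeness of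
  `𝒪_F` (Serre, *Local Fields*, Ch. XIII §5 proof of Prop. 15 / Fontaine–Ouyang Prop. 0.? :
  `(K̂^nr)^{G_K} = K`).

These are the ring-theoretic half of the period-ring datum `B = F̂_nr = Frac 𝒪̂_{F_nr}`
(`B^{Γ_F} = F`), assembled in `UnramifiedPeriodRing`.  Definitions: `maxUnramifiedCompletion`
(abbrev), `maxUnramifiedCompletion.galAut` (+ the action instance). No named facts.

## References

* [SerreLocalFields1979] J.-P. Serre, *Local Fields*, GTM 67, Ch. II §4–§5 (complete DVRs,
  `W(k̄)`), Ch. XIII §5.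
* J.-M. Fontaine, Y. Ouyang, *Theory of p-adic Galois representations*, §0.2, Prop. 3.? (`K̂^nr`).
* [Matsumura1987] H. Matsumura, *Commutative Ring Theory*, Thm. 8.11, §19 (completion of a
  regular local ring).
-/

noncomputable section

open ValuativeRel Field IsLocalRing AdicCompletion
open Literature.AlgebraicGeometry.Resolution
open scoped Pointwise

namespace Literature.NumberTheory.GaloisRepresentations
namespace IsNonarchimedeanLocalField

universe u

variable (F : Type u) [Field F] [ValuativeRel F] [TopologicalSpace F] [IsNonarchimedeanLocalField F]

/-! ### The completion `𝒪̂_{F_nr}` -/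

/-- **`𝒪̂_{F_nr}`**, the completion of the ring of integers of the maximal unramified extension of
`F` for its maximal-ideal-adic (= `ϖ_F`-adic) topology: the ring of integers of `F̂_nr`, i.e.
`W(k̄) ⊗_{W(k)} 𝒪_F`.  An `abbrev` for Mathlib's `AdicCompletion`, so that its ring, algebra,
local-ring and completeness instances apply. Serre, *Local Fields*, Ch. II §5.
[cite: SerreLocalFields1979, Ch. II §5] -/
abbrev maxUnramifiedCompletion : Type u :=
  AdicCompletion (maximalIdeal (maxUnramifiedIntegers F)) (maxUnramifiedIntegers F)

/-- `𝒪̂_{F_nr}` is a Noetherian ring (completion of a Noetherian ring, Stacks 0316).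
[cite: Matsumura1987, Thm. 8.11] -/
instance maxUnramifiedCompletion.instIsNoetherianRing : IsNoetherianRing (maxUnramifiedCompletion F) :=
  isNoetherianRing_adicCompletion_maximalIdeal _

/-- `𝒪̂_{F_nr}` is a regular local ring (completion of the regular local ring `𝒪_{F_nr}`).
[cite: Matsumura1987, §19 p. 158 (proof of Thm. 19.5)] -/
instance maxUnramifiedCompletion.instIsRegularLocalRing : IsRegularLocalRing (maxUnramifiedCompletion F) :=
  isRegularLocalRing_adicCompletion _

/-- `𝒪̂_{F_nr}` is a domain (regular local rings are domains). [cite: Matsumura1987, Thm. 14.3] -/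
instance maxUnramifiedCompletion.instIsDomain : IsDomain (maxUnramifiedCompletion F) :=
  isDomain_of_isRegularLocalRing _

/-- `dim 𝒪̂_{F_nr} = 1`. [cite: Matsumura1987, Thm. 15.1] -/
theorem maxUnramifiedCompletion.ringKrullDim_eq_one : ringKrullDim (maxUnramifiedCompletion F) = 1 :=
  (ringKrullDim_adicCompletion (maxUnramifiedIntegers F)).trans
    (IsPrincipalIdealRing.ringKrullDim_eq_one _ (IsDiscreteValuationRing.not_isField _))

/-- **`𝒪̂_{F_nr}` is a (complete) discrete valuation ring.** Serre, *Local Fields*, Ch. II §5.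
[cite: SerreLocalFields1979, Ch. II §5] -/
instance maxUnramifiedCompletion.instIsDiscreteValuationRing :
    IsDiscreteValuationRing (maxUnramifiedCompletion F) :=
  isDiscreteValuationRing_of_isRegularLocalRing_of_ringKrullDim_eq_one _
    (maxUnramifiedCompletion.ringKrullDim_eq_one F)

variable {F}

/-- The maximal ideal of `𝒪̂_{F_nr}` is the extension of that of `𝒪_{F_nr}`. [folklore] -/
theorem maxUnramifiedCompletion.maximalIdeal_eq_map :
    maximalIdeal (maxUnramifiedCompletion F) =
      (maximalIdeal (maxUnramifiedIntegers F)).map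
        (algebraMap (maxUnramifiedIntegers F) (maxUnramifiedCompletion F)) :=
  AdicCompletion.maximalIdeal_eq_map

/-- **`ϖ_F` is a uniformiser of `𝒪̂_{F_nr}`**: its maximal ideal is generated by the image of a
uniformiser of `𝒪[F]` (`e(F̂_nr/F) = 1`). [cite: SerreLocalFields1979, Ch. IV §4 Prop. 16] -/
theorem maxUnramifiedCompletion.maximalIdeal_eq_span_uniformizer {ϖ : 𝒪[F]} (hϖ : Irreducible ϖ) :
    maximalIdeal (maxUnramifiedCompletion F) =
      Ideal.span {algebraMap 𝒪[F] (maxUnramifiedCompletion F) ϖ} := by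
  have h := IsNonarchimedeanLocalField.maximalIdeal_eq_span_uniformizer (F := F) hϖ
  calc maximalIdeal (maxUnramifiedCompletion F)
      = (maximalIdeal (maxUnramifiedIntegers F)).map
          (algebraMap (maxUnramifiedIntegers F) (maxUnramifiedCompletion F)) :=
        maxUnramifiedCompletion.maximalIdeal_eq_map
    _ = (Ideal.span {algebraMap 𝒪[F] (maxUnramifiedIntegers F) ϖ}).map
          (algebraMap (maxUnramifiedIntegers F) (maxUnramifiedCompletion F)) :=
        congrArg (Ideal.map (algebraMap (maxUnramifiedIntegers F) (maxUnramifiedCompletion F))) h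
    _ = Ideal.span {algebraMap 𝒪[F] (maxUnramifiedCompletion F) ϖ} := by
        rw [Ideal.map_span, Set.image_singleton]
        rfl

/-- The image of a uniformiser of `𝒪[F]` in `𝒪̂_{F_nr}` is irreducible. [folklore] -/
theorem maxUnramifiedCompletion.irreducible_algebraMap_uniformizer {ϖ : 𝒪[F]} (hϖ : Irreducible ϖ) :
    Irreducible (algebraMap 𝒪[F] (maxUnramifiedCompletion F) ϖ) :=
  (IsDiscreteValuationRing.irreducible_iff_uniformizer _).2
    (maxUnramifiedCompletion.maximalIdeal_eq_span_uniformizer hϖ)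

/-- The image of a uniformiser of `𝒪[F]` in `𝒪̂_{F_nr}` is non-zero. [folklore] -/
theorem maxUnramifiedCompletion.algebraMap_uniformizer_ne_zero {ϖ : 𝒪[F]} (hϖ : Irreducible ϖ) :
    algebraMap 𝒪[F] (maxUnramifiedCompletion F) ϖ ≠ 0 :=
  (maxUnramifiedCompletion.irreducible_algebraMap_uniformizer hϖ).ne_zero

/-- `𝒪[F] → 𝒪̂_{F_nr}` factors through `𝒪_{F_nr}`. [folklore] -/
theorem maxUnramifiedCompletion.algebraMap_eq (a : 𝒪[F]) :
    algebraMap 𝒪[F] (maxUnramifiedCompletion F) a =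
      algebraMap (maxUnramifiedIntegers F) (maxUnramifiedCompletion F)
        (algebraMap 𝒪[F] (maxUnramifiedIntegers F) a) := by
  rw [AdicCompletion.algebraMap_apply, AdicCompletion.algebraMap_apply, Algebra.algebraMap_self,
    RingHom.id_apply]

/-! ### Density of `𝒪_{F_nr}` modulo `𝔪̂`; units -/

/-- The image of `c ∈ 𝒪_{F_nr}` lies in `𝔪̂` iff `c ∈ 𝔪` (`𝒪_{F_nr} → 𝒪̂_{F_nr}` is a local
homomorphism). [folklore] -/
theorem maxUnramifiedCompletion.algebraMap_mem_maximalIdeal_iff (c : maxUnramifiedIntegers F) :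
    algebraMap (maxUnramifiedIntegers F) (maxUnramifiedCompletion F) c ∈
        maximalIdeal (maxUnramifiedCompletion F) ↔
      c ∈ maximalIdeal (maxUnramifiedIntegers F) := by
  rw [IsLocalRing.mem_maximalIdeal, IsLocalRing.mem_maximalIdeal, mem_nonunits_iff, mem_nonunits_iff,
    not_iff_not]
  exact isUnit_map_iff (algebraMap (maxUnramifiedIntegers F) (maxUnramifiedCompletion F)) c

/-- **`𝒪_{F_nr}` is dense in `𝒪̂_{F_nr}` modulo `𝔪̂`**: every element is congruent to the image of
an element of `𝒪_{F_nr}` (the residue fields agree, Mathlib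
`AdicCompletion.residueField_map_bijective`). [cite: Matsumura1987, Thm. 8.11] -/
theorem maxUnramifiedCompletion.exists_sub_of_mem_maximalIdeal (x : maxUnramifiedCompletion F) :
    ∃ b : maxUnramifiedIntegers F,
      x - algebraMap (maxUnramifiedIntegers F) (maxUnramifiedCompletion F) b ∈
        maximalIdeal (maxUnramifiedCompletion F) := by
  obtain ⟨z, hz⟩ := (AdicCompletion.residueField_map_bijective (maxUnramifiedIntegers F)).2
    (IsLocalRing.residue _ x)
  obtain ⟨b, rfl⟩ := IsLocalRing.residue_surjective z
  refine ⟨b, ?_⟩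
  rw [IsLocalRing.ResidueField.map_residue] at hz
  rw [← Ideal.Quotient.eq]
  exact hz.symm

/-! ### The Galois action on `𝒪̂_{F_nr}` -/

/-- A Galois automorphism maps the maximal ideal of `𝒪_{F_nr}` onto itself. [folklore] -/
theorem map_maximalIdeal_toRingEquiv (σ : absoluteGaloisGroup F) :
    (maximalIdeal (maxUnramifiedIntegers F)).map
        (MulSemiringAction.toRingEquiv _ (maxUnramifiedIntegers F) σ).toRingHom =
      maximalIdeal (maxUnramifiedIntegers F) := by
  refine le_antisymm ?_ fun b hb => ?_
  · rw [Ideal.map_le_iff_le_comap]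
    intro b hb
    exact smul_mem_maximalIdeal σ hb
  · have h : b = (MulSemiringAction.toRingEquiv _ (maxUnramifiedIntegers F) σ).toRingHom (σ⁻¹ • b) := by
      change b = σ • σ⁻¹ • b
      rw [smul_inv_smul]
    rw [h]
    exact Ideal.mem_map_of_mem _ (smul_mem_maximalIdeal σ⁻¹ hb)

variable (F) in
/-- **The action of `Gal(F̄/F)` on `𝒪̂_{F_nr}`** by continuity: `σ` preserves `𝔪`, hence induces an
automorphism of the completion (transport of adic completions along `σ : 𝒪_{F_nr} ≃ 𝒪_{F_nr}`),
as a homomorphism `Gal(F̄/F) → Aut(𝒪̂_{F_nr})`.  (Used as an explicit homomorphism; the period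
field `F̂_nr` receives the induced `MulSemiringAction`.) Serre, *Local Fields*, Ch. II §3
(continuity of Galois on completions). [cite: SerreLocalFields1979, Ch. II §5] -/
def maxUnramifiedCompletion.galAut :
    absoluteGaloisGroup F →* (maxUnramifiedCompletion F ≃+* maxUnramifiedCompletion F) where
  toFun σ := adicCompletionCongr _ _ (MulSemiringAction.toRingEquiv _ (maxUnramifiedIntegers F) σ)
    (map_maximalIdeal_toRingEquiv σ)
  map_one' := by
    refine RingEquiv.ext fun x => ?_
    change adicCompletionMap _ _ _ _ x = x
    rw [adicCompletionMap_congr _ _ (g := RingHom.id _) (by ext b; simp) _ (by simp),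
      adicCompletionMap_id]
  map_mul' σ τ := by
    refine RingEquiv.ext fun x => ?_
    change adicCompletionMap _ _ _ _ x = adicCompletionMap _ _ _ _ (adicCompletionMap _ _ _ _ x)
    rw [adicCompletionMap_comp]
    exact adicCompletionMap_congr _ _ (by ext b; simp) _ _ x

/-- `galAut σ x` is the map induced on completions by `σ`. [folklore] -/
theorem maxUnramifiedCompletion.galAut_eq_adicCompletionMap (σ : absoluteGaloisGroup F)
    (x : maxUnramifiedCompletion F) :
    maxUnramifiedCompletion.galAut F σ x =
      adicCompletionMap _ _ (MulSemiringAction.toRingHom _ (maxUnramifiedIntegers F) σ)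
        (map_maximalIdeal_toRingEquiv σ).le x := rfl

/-- **The action extends that on `𝒪_{F_nr}`**: `σ(ι b) = ι(σ • b)`. [folklore] -/
@[simp] theorem maxUnramifiedCompletion.galAut_of (σ : absoluteGaloisGroup F) (b : maxUnramifiedIntegers F) :
    maxUnramifiedCompletion.galAut F σ (of (maximalIdeal (maxUnramifiedIntegers F)) (maxUnramifiedIntegers F) b) =
      of (maximalIdeal (maxUnramifiedIntegers F)) (maxUnramifiedIntegers F) (σ • b) := by
  rw [maxUnramifiedCompletion.galAut_eq_adicCompletionMap, adicCompletionMap_of]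
  rfl

/-- `σ(ι b) = ι(σ • b)` for the algebra map `ι : 𝒪_{F_nr} → 𝒪̂_{F_nr}`. [folklore] -/
@[simp] theorem maxUnramifiedCompletion.galAut_algebraMap' (σ : absoluteGaloisGroup F)
    (b : maxUnramifiedIntegers F) :
    maxUnramifiedCompletion.galAut F σ (algebraMap (maxUnramifiedIntegers F) (maxUnramifiedCompletion F) b) =
      algebraMap (maxUnramifiedIntegers F) (maxUnramifiedCompletion F) (σ • b) := by
  rw [AdicCompletion.algebraMap_apply, Algebra.algebraMap_self, RingHom.id_apply,
    maxUnramifiedCompletion.galAut_of, AdicCompletion.algebraMap_apply, Algebra.algebraMap_self,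
    RingHom.id_apply]

/-- The action fixes `𝒪[F] ⊆ 𝒪̂_{F_nr}` pointwise. [folklore] -/
@[simp] theorem maxUnramifiedCompletion.galAut_algebraMap (σ : absoluteGaloisGroup F) (a : 𝒪[F]) :
    maxUnramifiedCompletion.galAut F σ (algebraMap 𝒪[F] (maxUnramifiedCompletion F) a) =
      algebraMap 𝒪[F] (maxUnramifiedCompletion F) a := by
  rw [maxUnramifiedCompletion.algebraMap_eq, maxUnramifiedCompletion.galAut_algebraMap',
    maxUnramifiedIntegers.smul_algebraMap]

/-- The components of `σ x`: `(σ x)_n = σ (x_n)` in `𝒪_{F_nr} ⧸ 𝔪 ^ n`. [folklore] -/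
theorem maxUnramifiedCompletion.evalₐ_galAut (σ : absoluteGaloisGroup F) (n : ℕ)
    (x : maxUnramifiedCompletion F) :
    evalₐ (maximalIdeal (maxUnramifiedIntegers F)) n (maxUnramifiedCompletion.galAut F σ x) =
      Ideal.quotientMap _ (MulSemiringAction.toRingHom _ (maxUnramifiedIntegers F) σ)
        (pow_le_comap_pow_of_map_le _ (map_maximalIdeal_toRingEquiv σ).le n)
        (evalₐ (maximalIdeal (maxUnramifiedIntegers F)) n x) := by
  rw [maxUnramifiedCompletion.galAut_eq_adicCompletionMap, evalₐ_adicCompletionMap]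

/-- Components of `σ x` on representatives: if `x_n = b mod 𝔪ⁿ` then `(σ x)_n = σ b mod 𝔪ⁿ`.
[folklore] -/
theorem maxUnramifiedCompletion.evalₐ_galAut_of_eq (σ : absoluteGaloisGroup F) (n : ℕ)
    (x : maxUnramifiedCompletion F) (b : maxUnramifiedIntegers F)
    (hb : evalₐ (maximalIdeal (maxUnramifiedIntegers F)) n x = Ideal.Quotient.mk _ b) :
    evalₐ (maximalIdeal (maxUnramifiedIntegers F)) n (maxUnramifiedCompletion.galAut F σ x) =
      Ideal.Quotient.mk _ (σ • b) := by
  rw [maxUnramifiedCompletion.evalₐ_galAut, hb, Ideal.quotientMap_mk]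
  rfl

/-- **The inertia group acts trivially on `𝒪̂_{F_nr}`.** [cite: SerreInventiones1972, §1.2] -/
theorem maxUnramifiedCompletion.galAut_eq_self_of_mem_absInertia {σ : absoluteGaloisGroup F}
    (hσ : σ ∈ absInertia F) (x : maxUnramifiedCompletion F) : maxUnramifiedCompletion.galAut F σ x = x := by
  refine ext_evalₐ fun n => ?_
  obtain ⟨b, hb⟩ := Ideal.Quotient.mk_surjective (evalₐ (maximalIdeal (maxUnramifiedIntegers F)) n x)
  rw [maxUnramifiedCompletion.evalₐ_galAut_of_eq σ n x b hb.symm, ← hb,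
    maxUnramifiedIntegers.smul_eq_self_of_mem_absInertia hσ]

/-- `galAut σ` preserves the maximal ideal of `𝒪̂_{F_nr}`. [folklore] -/
theorem maxUnramifiedCompletion.galAut_mem_maximalIdeal (σ : absoluteGaloisGroup F)
    {m : maxUnramifiedCompletion F} (hm : m ∈ maximalIdeal (maxUnramifiedCompletion F)) :
    maxUnramifiedCompletion.galAut F σ m ∈ maximalIdeal (maxUnramifiedCompletion F) := by
  rw [IsLocalRing.mem_maximalIdeal, mem_nonunits_iff] at hm ⊢
  intro h
  apply hm
  have := h.map (maxUnramifiedCompletion.galAut F σ).symm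
  rwa [RingEquiv.symm_apply_apply] at this

/-- **An arithmetic Frobenius acts on `𝒪̂_{F_nr}` as `x ↦ x ^ q` modulo `𝔪̂`** (write
`x = ι(b) + m` with `m ∈ 𝔪̂`; `σ ι(b) - ι(b)^q = ι(σ b - b^q) ∈ 𝔪̂`).
[cite: TateCorvallis1979, §1.4 (1.4.1)] -/
theorem IsAbsArithFrob.galAut_sub_pow_mem_maximalIdeal {σ : absoluteGaloisGroup F}
    (hσ : IsAbsArithFrob σ) (x : maxUnramifiedCompletion F) :
    maxUnramifiedCompletion.galAut F σ x - x ^ residueFieldCard F ∈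
      maximalIdeal (maxUnramifiedCompletion F) := by
  set I := maximalIdeal (maxUnramifiedIntegers F) with hI
  obtain ⟨b, hb⟩ := maxUnramifiedCompletion.exists_sub_of_mem_maximalIdeal x
  set m := x - algebraMap (maxUnramifiedIntegers F) (maxUnramifiedCompletion F) b with hm
  have hx : x = algebraMap (maxUnramifiedIntegers F) (maxUnramifiedCompletion F) b + m := by rw [hm]; abel
  have h1 : maxUnramifiedCompletion.galAut F σ (algebraMap (maxUnramifiedIntegers F) (maxUnramifiedCompletion F) b) - algebraMap (maxUnramifiedIntegers F) (maxUnramifiedCompletion F) b ^ residueFieldCard F ∈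
      maximalIdeal (maxUnramifiedCompletion F) := by
    rw [maxUnramifiedCompletion.galAut_algebraMap', ← map_pow, ← map_sub,
      maxUnramifiedCompletion.algebraMap_mem_maximalIdeal_iff]
    exact IsAbsArithFrob.smul_sub_pow_mem_maximalIdeal hσ b
  have h2 : (algebraMap (maxUnramifiedIntegers F) (maxUnramifiedCompletion F) b + m) ^ residueFieldCard F -
      algebraMap (maxUnramifiedIntegers F) (maxUnramifiedCompletion F) b ^ residueFieldCard F ∈ maximalIdeal (maxUnramifiedCompletion F) := by
    have hdvd := sub_dvd_pow_sub_pow (algebraMap (maxUnramifiedIntegers F) (maxUnramifiedCompletion F) b + m)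
      (algebraMap (maxUnramifiedIntegers F) (maxUnramifiedCompletion F) b) (residueFieldCard F)
    rw [add_sub_cancel_left] at hdvd
    exact Ideal.mem_of_dvd _ hdvd hb
  have h3 := maxUnramifiedCompletion.galAut_mem_maximalIdeal σ hb
  have key : maxUnramifiedCompletion.galAut F σ x - x ^ residueFieldCard F =
      (maxUnramifiedCompletion.galAut F σ (algebraMap (maxUnramifiedIntegers F) (maxUnramifiedCompletion F) b) - algebraMap (maxUnramifiedIntegers F) (maxUnramifiedCompletion F) b ^ residueFieldCard F) +
        maxUnramifiedCompletion.galAut F σ m -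
        ((algebraMap (maxUnramifiedIntegers F) (maxUnramifiedCompletion F) b + m) ^ residueFieldCard F -
          algebraMap (maxUnramifiedIntegers F) (maxUnramifiedCompletion F) b ^ residueFieldCard F) := by
    conv_lhs => rw [hx]
    rw [map_add]
    ring
  rw [key]
  exact sub_mem (add_mem h1 h3) h2

/-- For `d ∈ 𝒪̂_{F_nr}` with `σ₀ d ≡ d (mod 𝔪̂)` (`σ₀` an arithmetic Frobenius) there is
`e ∈ 𝒪[F]` with `d ≡ e (mod 𝔪̂)`: **the Frobenius-fixed points of the residue field `k̄` are `k`.**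
[cite: SerreLocalFields1979, Ch. IV §4 Cor. 2 to Prop. 16] -/
theorem IsAbsArithFrob.exists_sub_algebraMap_mem_maximalIdeal {σ : absoluteGaloisGroup F}
    (hσ : IsAbsArithFrob σ) (d : maxUnramifiedCompletion F)
    (hd : maxUnramifiedCompletion.galAut F σ d - d ∈ maximalIdeal (maxUnramifiedCompletion F)) :
    ∃ e : 𝒪[F], d - algebraMap 𝒪[F] (maxUnramifiedCompletion F) e ∈
      maximalIdeal (maxUnramifiedCompletion F) := by
  set I := maximalIdeal (maxUnramifiedIntegers F) with hI
  obtain ⟨b, hb⟩ := maxUnramifiedCompletion.exists_sub_of_mem_maximalIdeal d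
  set m := d - algebraMap (maxUnramifiedIntegers F) (maxUnramifiedCompletion F) b with hm
  have hdx : d = algebraMap (maxUnramifiedIntegers F) (maxUnramifiedCompletion F) b + m := by rw [hm]; abel
  -- `σ b ≡ b` and `σ b ≡ b ^ q` modulo `𝔪`, so `b ^ q ≡ b`
  have h1 : σ • b - b ∈ I := by
    have key : algebraMap (maxUnramifiedIntegers F) (maxUnramifiedCompletion F) (σ • b - b) =
        (maxUnramifiedCompletion.galAut F σ d - d) - (maxUnramifiedCompletion.galAut F σ m - m) := by
      rw [map_sub, ← maxUnramifiedCompletion.galAut_algebraMap']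
      conv_rhs => rw [hdx]
      rw [map_add]
      ring
    rw [← maxUnramifiedCompletion.algebraMap_mem_maximalIdeal_iff, key]
    exact sub_mem hd (sub_mem (maxUnramifiedCompletion.galAut_mem_maximalIdeal σ hb) hb)
  have h2 : b ^ residueFieldCard F - b ∈ I := by
    have := sub_mem h1 (IsAbsArithFrob.smul_sub_pow_mem_maximalIdeal hσ b)
    rwa [sub_sub_sub_cancel_left] at this
  -- hence the residue of `b` lies in `𝓀[F]`
  have h3 : maxUnramifiedIntegers.residueHom F b ^ residueFieldCard F =
      maxUnramifiedIntegers.residueHom F b := by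
    rw [← map_pow, ← sub_eq_zero, ← map_sub, ← RingHom.mem_ker, maxUnramifiedIntegers.ker_residueHom]
    exact h2
  obtain ⟨ebar, hebar⟩ := mem_range_algebraMap_of_pow_residueFieldCard_eq h3
  obtain ⟨e, rfl⟩ := IsLocalRing.residue_surjective ebar
  refine ⟨e, ?_⟩
  -- `b ≡ e` in `𝒪_{F_nr}`
  have h4 : b - algebraMap 𝒪[F] (maxUnramifiedIntegers F) e ∈ I := by
    rw [hI, ← maxUnramifiedIntegers.ker_residueHom, RingHom.mem_ker, map_sub, sub_eq_zero, ← hebar,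
      maxUnramifiedIntegers.residueHom_algebraMap]
  have key : d - algebraMap 𝒪[F] (maxUnramifiedCompletion F) e =
      algebraMap (maxUnramifiedIntegers F) (maxUnramifiedCompletion F)
        (b - algebraMap 𝒪[F] (maxUnramifiedIntegers F) e) + m := by
    rw [map_sub, ← maxUnramifiedCompletion.algebraMap_eq, hdx]
    ring
  rw [key]
  exact add_mem ((maxUnramifiedCompletion.algebraMap_mem_maximalIdeal_iff _).2 h4) hb

/-! ### Frobenius invariants of `𝒪̂_{F_nr}` -/

/-- Cancellation: if `ϖ ^ n y` is `σ`-fixed (`ϖ ∈ 𝒪[F]`) then so is `y`. [folklore] -/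
theorem maxUnramifiedCompletion.galAut_eq_self_of_mul_pow {σ : absoluteGaloisGroup F} {ϖ : 𝒪[F]}
    (hϖ : Irreducible ϖ) (n : ℕ) {y : maxUnramifiedCompletion F}
    (h : maxUnramifiedCompletion.galAut F σ (algebraMap 𝒪[F] (maxUnramifiedCompletion F) ϖ ^ n * y) =
      algebraMap 𝒪[F] (maxUnramifiedCompletion F) ϖ ^ n * y) :
    maxUnramifiedCompletion.galAut F σ y = y := by
  rw [map_mul, map_pow, maxUnramifiedCompletion.galAut_algebraMap] at h
  exact mul_left_cancel₀ (pow_ne_zero n (maxUnramifiedCompletion.algebraMap_uniformizer_ne_zero hϖ)) h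

/-- **Approximation of Frobenius invariants**: if `σ₀ x = x` (`σ₀` an arithmetic Frobenius) then
for every `n` there is `c ∈ 𝒪[F]` with `x ≡ c (mod 𝔪̂ ^ n)` (dévissage along powers of the
uniformiser `ϖ_F`, using `k̄^{Frob} = k`). [cite: SerreLocalFields1979, Ch. IV §4 Cor. 2 to Prop. 16] -/
theorem IsAbsArithFrob.exists_sub_algebraMap_mem_pow {σ : absoluteGaloisGroup F} (hσ : IsAbsArithFrob σ)
    {x : maxUnramifiedCompletion F} (hx : maxUnramifiedCompletion.galAut F σ x = x) (n : ℕ) :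
    ∃ c : 𝒪[F], x - algebraMap 𝒪[F] (maxUnramifiedCompletion F) c ∈
      maximalIdeal (maxUnramifiedCompletion F) ^ n := by
  obtain ⟨ϖ, hϖ⟩ := IsDiscreteValuationRing.exists_irreducible 𝒪[F]
  have hspan := maxUnramifiedCompletion.maximalIdeal_eq_span_uniformizer (F := F) hϖ
  induction n with
  | zero => exact ⟨0, by rw [pow_zero, Ideal.one_eq_top]; exact Submodule.mem_top⟩
  | succ n ih =>
    obtain ⟨c, hc⟩ := ih
    -- `x - c = ϖ ^ n * d` with `d` Frobenius-fixed
    rw [hspan, Ideal.span_singleton_pow, Ideal.mem_span_singleton] at hc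
    obtain ⟨d, hd⟩ := hc
    have hdfix : maxUnramifiedCompletion.galAut F σ d = d := by
      refine maxUnramifiedCompletion.galAut_eq_self_of_mul_pow hϖ n ?_
      rw [← hd, map_sub, hx, maxUnramifiedCompletion.galAut_algebraMap]
    obtain ⟨e, he⟩ := IsAbsArithFrob.exists_sub_algebraMap_mem_maximalIdeal hσ d
      (by rw [hdfix, sub_self]; exact zero_mem _)
    refine ⟨c + ϖ ^ n * e, ?_⟩
    rw [hspan, Ideal.mem_span_singleton] at he
    obtain ⟨f, hf⟩ := he
    rw [hspan, Ideal.span_singleton_pow, Ideal.mem_span_singleton]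
    refine ⟨f, ?_⟩
    rw [map_add, map_mul, map_pow, ← sub_sub, hd, ← mul_sub, hf, pow_succ, mul_assoc]

/-- **Faithfulness of `𝒪[F] → 𝒪̂_{F_nr}` on powers of the maximal ideal**: `a ∈ 𝓂[F] ^ n` iff
its image lies in `𝔪̂ ^ n` (`ϖ_F` is a uniformiser of both discrete valuation rings).
[cite: SerreLocalFields1979, Ch. IV §4 Prop. 16] -/
theorem maxUnramifiedCompletion.algebraMap_mem_maximalIdeal_pow_iff (n : ℕ) (a : 𝒪[F]) :
    algebraMap 𝒪[F] (maxUnramifiedCompletion F) a ∈ maximalIdeal (maxUnramifiedCompletion F) ^ n ↔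
      a ∈ 𝓂[F] ^ n := by
  obtain ⟨ϖ, hϖ⟩ := IsDiscreteValuationRing.exists_irreducible 𝒪[F]
  have hspanF : 𝓂[F] = Ideal.span {ϖ} := (IsDiscreteValuationRing.irreducible_iff_uniformizer ϖ).1 hϖ
  have hspan := maxUnramifiedCompletion.maximalIdeal_eq_span_uniformizer (F := F) hϖ
  rw [hspan, hspanF, Ideal.span_singleton_pow, Ideal.span_singleton_pow, Ideal.mem_span_singleton,
    Ideal.mem_span_singleton]
  constructor
  · intro h
    by_cases ha : a = 0
    · rw [ha]; exact dvd_zero _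
    obtain ⟨k, u, rfl⟩ := IsDiscreteValuationRing.eq_unit_mul_pow_irreducible ha hϖ
    rw [map_mul, map_pow, mul_comm] at h
    -- `ϖ ^ n ∣ ϖ ^ k * u` in the DVR `𝒪̂_{F_nr}` forces `n ≤ k`
    have hu : IsUnit (algebraMap 𝒪[F] (maxUnramifiedCompletion F) (u : 𝒪[F])) := u.isUnit.map _
    rw [IsUnit.dvd_mul_right hu] at h
    have hirr := maxUnramifiedCompletion.irreducible_algebraMap_uniformizer (F := F) hϖ
    have hnk : n ≤ k := by
      by_contra hlt
      push Not at hlt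
      have h' : algebraMap 𝒪[F] (maxUnramifiedCompletion F) ϖ ^ (k + 1) ∣
          algebraMap 𝒪[F] (maxUnramifiedCompletion F) ϖ ^ k := (pow_dvd_pow _ hlt).trans h
      rw [pow_succ] at h'
      have hk0 : algebraMap 𝒪[F] (maxUnramifiedCompletion F) ϖ ^ k ≠ 0 :=
        pow_ne_zero _ hirr.ne_zero
      obtain ⟨z, hz⟩ := h'
      have : algebraMap 𝒪[F] (maxUnramifiedCompletion F) ϖ * z = 1 := by
        apply mul_left_cancel₀ hk0
        rw [← mul_assoc, ← hz, mul_one]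
      exact hirr.not_isUnit (IsUnit.of_mul_eq_one z this)
    rw [mul_comm]
    exact (pow_dvd_pow ϖ hnk).mul_right _
  · rintro ⟨z, rfl⟩
    rw [map_mul, map_pow]
    exact dvd_mul_right _ _

/-- **`(𝒪̂_{F_nr})^{σ₀} = 𝒪_F`**: an element of `𝒪̂_{F_nr}` fixed by an arithmetic Frobenius `σ₀` is
the image of an element of `𝒪[F]` (approximate modulo `𝔪̂ⁿ` by `cₙ ∈ 𝒪[F]`; `(cₙ)` is Cauchy in the
complete ring `𝒪[F]`; its limit maps to `x` by separatedness of `𝒪̂_{F_nr}`). This is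
`(F̂_nr)^{Gal} = F` at the integral level. [cite: SerreLocalFields1979, Ch. IV §4 Cor. 2 to Prop. 16] -/
theorem IsAbsArithFrob.mem_range_algebraMap_of_galAut_eq {σ : absoluteGaloisGroup F} (hσ : IsAbsArithFrob σ)
    {x : maxUnramifiedCompletion F} (hx : maxUnramifiedCompletion.galAut F σ x = x) :
    x ∈ Set.range (algebraMap 𝒪[F] (maxUnramifiedCompletion F)) := by
  choose c hc using IsAbsArithFrob.exists_sub_algebraMap_mem_pow hσ hx
  -- `(c n)` is Cauchy in `𝒪[F]`
  have hcauchy : ∀ {m n}, m ≤ n → c m ≡ c n [SMOD (𝓂[F] ^ m • ⊤ : Submodule 𝒪[F] 𝒪[F])] := by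
    intro m n hmn
    rw [SModEq.sub_mem, smul_eq_mul, Ideal.mul_top,
      ← maxUnramifiedCompletion.algebraMap_mem_maximalIdeal_pow_iff, map_sub]
    have : algebraMap 𝒪[F] (maxUnramifiedCompletion F) (c m) - algebraMap 𝒪[F] _ (c n) =
        (x - algebraMap 𝒪[F] _ (c n)) - (x - algebraMap 𝒪[F] _ (c m)) := by ring
    rw [this]
    exact sub_mem (Ideal.pow_le_pow_right hmn (hc n)) (hc m)
  haveI : IsAdicComplete 𝓂[F] 𝒪[F] := LocalField.isAdicComplete_maximalIdeal F
  obtain ⟨a, ha⟩ := IsPrecomplete.prec' c hcauchy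
  refine ⟨a, ?_⟩
  -- `x - a ∈ 𝔪̂ ^ n` for all `n`
  rw [eq_comm, ← sub_eq_zero]
  refine IsHausdorff.haus' (I := maximalIdeal (maxUnramifiedCompletion F)) _ fun n => ?_
  rw [SModEq.zero, smul_eq_mul, Ideal.mul_top]
  have h1 : a - c n ∈ 𝓂[F] ^ n := by
    have := (ha n).symm
    rwa [SModEq.sub_mem, smul_eq_mul, Ideal.mul_top] at this
  have h2 := (maxUnramifiedCompletion.algebraMap_mem_maximalIdeal_pow_iff n _).2 h1
  rw [map_sub] at h2
  have : x - algebraMap 𝒪[F] (maxUnramifiedCompletion F) a =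
      (x - algebraMap 𝒪[F] _ (c n)) - (algebraMap 𝒪[F] _ a - algebraMap 𝒪[F] _ (c n)) := by ring
  rw [this]
  exact sub_mem (hc n) h2

/-- **`(𝒪̂_{F_nr})^{Gal(F̄/F)} = 𝒪_F`.** [cite: SerreLocalFields1979, Ch. IV §4 Cor. 2 to Prop. 16] -/
theorem maxUnramifiedCompletion.mem_range_algebraMap_of_forall_galAut_eq {x : maxUnramifiedCompletion F}
    (hx : ∀ σ : absoluteGaloisGroup F, maxUnramifiedCompletion.galAut F σ x = x) :
    x ∈ Set.range (algebraMap 𝒪[F] (maxUnramifiedCompletion F)) := by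
  obtain ⟨σ, hσ⟩ := exists_isAbsArithFrob_holds (F := F)
  exact IsAbsArithFrob.mem_range_algebraMap_of_galAut_eq hσ (hx σ)

end IsNonarchimedeanLocalField
end Literature.NumberTheory.GaloisRepresentations

end
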